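import Mathlib
import Summits.KontsevichZagierPeriods.KontsevichZagierPeriods.Theorems.TorsionLogsGKZLevelThreePairTChainCubeRootB
import Summits.KontsevichZagierPeriods.KontsevichZagierPeriods.Theorems.TorsionLogsGKZLevelThreePairTChainFold
import Summits.KontsevichZagierPeriods.KontsevichZagierPeriods.Theorems.TorsionLogsGKZLevelThreePairTChainAffine
import Literature.NumberTheory.Transcendental.KZCalculus
import Literature.NumberTheory.Transcendental.KZLogCalculusProofs
import Literature.NumberTheory.Transcendental.KZDominatedFamilyRelations
import Literature.NumberTheory.Transcendental.KZSemialgebraicComplex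
import Literature.NumberTheory.Transcendental.SemialgebraicMapsProofs
import Literature.NumberTheory.Transcendental.EllIterRep
import Literature.NumberTheory.Transcendental.KZProductIdeal

/-!
# Route TorsionLogs — support item `GKZLevelThreePair`: the T-chain, intermediate representations
# (`R2`, `R2band`, `R3` exist; two generic existence principles)

Helper file for item `stmt-KontsevichZagierPeriods-13812` (`GKZLevelThreePair`), blueprint v3.
The moves of the T-chain (`Trep ∼ R1 ∼ R2 ∼ R2band ∼ R3 ∼ Rb ∼ R4 ∼ R5 ∼ L₆`) are stated for
PINNED representations; this file and `…TChainAssembly.lean` supply the intermediate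
representations (existence = semialgebraicity + integrability, the latter always inherited from a
neighbour in the chain) and compose them.  Here:

* `exists_rep_of_null_superset` — a representation on `D` from one on `C` with `D \ C` null;
* `exists_rep_of_preimage` — a representation on `D` from one on `Φ '' D` (Jacobian transport);
* `exists_R2` (sum of `3/Y` and the fold `3x/Y`), `exists_R2band` (null edges),
  `exists_R3` (affine chart `y = (1+x³)s/(2x√x)`, transported integrability).

## References

* M. Kontsevich, D. Zagier, *Periods* (2001), §1.2 rules (1)–(3).
-/

-- `Summit.<Summit>.<Sub>` with Sub = Summit (single-conjunct summit, D-0017) duplicates the segment.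
set_option linter.dupNamespace false

noncomputable section

namespace Summit.KontsevichZagierPeriods.KontsevichZagierPeriods.Theorems.GKZLevelThree

open Set MeasureTheory
open MvPolynomial (aeval X C)
open Literature.NumberTheory.Transcendental Literature.NumberTheory.Transcendental.KZ
open Literature.ModelTheory.ExponentialFields (IsSemialgebraic isSemialgebraic_setOf_eval_pos)

/-! ## Two generic existence principles -/

/-- A representation on a `ℚ`-semialgebraic set `D` with a `ℚ`-semialgebraic integrand `f` exists as
soon as `f` agrees with the integrand of a representation `r` on a measurable `C ⊆ r.domain` with
`D \ C` null (integrability on `C` is inherited, the rest is null). [folklore] -/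
theorem exists_rep_of_null_superset {n : ℕ} (r : IntegralRep n) {D C : Set (Fin n → ℝ)}
    (hD : IsSemialgebraic ℚ D) (hC : MeasurableSet C) (hCr : C ⊆ r.domain)
    (hnull : volume (D \ C) = 0) (f : (Fin n → ℝ) → ℝ) (hf : IsSemialgebraicFunOn ℚ D f)
    (hfC : EqOn f r.integrand C) : ∃ r₂ : IntegralRep n, r₂.domain = D ∧ r₂.integrand = f := by
  have h1 : IntegrableOn f C := (r.integrableOn.mono_set hCr).congr_fun hfC.symm hC
  have h2 : IntegrableOn f (D \ C) := IntegrableOn.of_measure_zero hnull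
  have hint : IntegrableOn f D := (h2.union h1).mono_set (subset_sdiff_union D C)
  exact ⟨⟨D, f, hD, hf, hint⟩, rfl, rfl⟩

/-- A representation on `D` with integrand `f` exists as soon as `f = (r'.integrand ∘ Φ) · |det Φ'|`
on `D` for an injective differentiable map `Φ` of `D` ONTO the domain of a representation `r'`
(Mathlib's change-of-variables criterion transports integrability backwards). [folklore] -/
theorem exists_rep_of_preimage {n : ℕ} (r' : IntegralRep n) {D : Set (Fin n → ℝ)} (hD : IsSemialgebraic ℚ D)
    (Φ : (Fin n → ℝ) → (Fin n → ℝ)) (Φ' : (Fin n → ℝ) → (Fin n → ℝ) →L[ℝ] (Fin n → ℝ))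
    (hder : ∀ x ∈ D, HasFDerivWithinAt Φ (Φ' x) D x) (hinj : InjOn Φ D) (himage : Φ '' D = r'.domain)
    (f : (Fin n → ℝ) → ℝ) (hf : IsSemialgebraicFunOn ℚ D f)
    (hint : ∀ x ∈ D, f x = r'.integrand (Φ x) * |(Φ' x).det|) :
    ∃ r : IntegralRep n, r.domain = D ∧ r.integrand = f := by
  have hmeas : MeasurableSet D := IsSemialgebraic.measurableSet_holds hD
  have h1 : IntegrableOn r'.integrand (Φ '' D) := himage ▸ r'.integrableOn
  rw [integrableOn_image_iff_integrableOn_abs_det_fderiv_smul volume hmeas hder hinj] at h1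
  have hfint : IntegrableOn f D :=
    h1.congr_fun (fun x hx => by beta_reduce; rw [hint x hx, smul_eq_mul, mul_comm]) hmeas
  exact ⟨⟨D, f, hD, hf, hfint⟩, rfl, rfl⟩

/-! ## The intermediate representations -/

/-- On `{0<x<1, 0≤y≤1}` the radicand `(x³+1)²-4y²x³ ≥ (1-x³)² > 0`. -/
theorem radicand_pos_of_le_one {x y : ℝ} (hx0 : 0 < x) (hx1 : x < 1) (hy0 : 0 ≤ y) (hy1 : y ≤ 1) :
    0 < (x ^ 3 + 1) ^ 2 - 4 * y ^ 2 * x ^ 3 := by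
  have hy2 : y ^ 2 ≤ 1 := by nlinarith
  have hx3 : 0 < x ^ 3 := by positivity
  have hx31 : x ^ 3 < 1 := pow_lt_one₀ hx0.le hx1 (by norm_num)
  nlinarith [mul_le_mul_of_nonneg_right hy2 hx3.le, sq_nonneg (1 - x ^ 3)]

/-- **`R2 = [(0,1)², 3(1+x)/Y]` exists** given `R1 = [(0,∞)×(0,1), 3/Y]`: its integrand is the sum
of `3/Y` (restriction of `R1`) and `3x/Y` (the fold of `R1|{x>1}`, `exists_foldedRep`). -/
theorem exists_R2 (R₁ : IntegralRep 2) (h1d : R₁.domain = {z | 0 < z 0 ∧ (0 < z 1 ∧ z 1 < 1)})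
    (h1i : EqOn R₁.integrand (fun z => 3 / Real.sqrt ((z 0 ^ 3 + 1) ^ 2 - 4 * z 1 ^ 2 * z 0 ^ 3)) R₁.domain) :
    ∃ R₂ : IntegralRep 2, R₂.domain = {z | (0 < z 0 ∧ z 0 < 1) ∧ (0 < z 1 ∧ z 1 < 1)} ∧
      R₂.integrand = fun z => 3 * (1 + z 0) / Real.sqrt ((z 0 ^ 3 + 1) ^ 2 - 4 * z 1 ^ 2 * z 0 ^ 3) := by
  set S2 : Set (Fin 2 → ℝ) := {z | (0 < z 0 ∧ z 0 < 1) ∧ (0 < z 1 ∧ z 1 < 1)} with hS2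
  set Sg : Set (Fin 2 → ℝ) := {z | 1 < z 0 ∧ (0 < z 1 ∧ z 1 < 1)} with hSg
  have hS2s : IsSemialgebraic ℚ S2 :=
    ((KZ.isSemialgebraic_setOf_const_lt_apply isAlgebraic_zero 0).inter
      (KZ.isSemialgebraic_setOf_apply_lt_const isAlgebraic_one 0)).inter
      ((KZ.isSemialgebraic_setOf_const_lt_apply isAlgebraic_zero 1).inter
      (KZ.isSemialgebraic_setOf_apply_lt_const isAlgebraic_one 1))
  have hSgs : IsSemialgebraic ℚ Sg :=
    (KZ.isSemialgebraic_setOf_const_lt_apply isAlgebraic_one 0).inter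
      ((KZ.isSemialgebraic_setOf_const_lt_apply isAlgebraic_zero 1).inter
      (KZ.isSemialgebraic_setOf_apply_lt_const isAlgebraic_one 1))
  have hS2sub : S2 ⊆ R₁.domain := by rw [h1d]; exact fun z hz => ⟨hz.1.1, hz.2⟩
  have hSgsub : Sg ⊆ R₁.domain := by rw [h1d]; exact fun z hz => ⟨by linarith [hz.1], hz.2⟩
  set H := R₁.restrict Sg hSgs hSgsub with hH
  obtain ⟨T, hTd, hTi⟩ := exists_foldedRep H (by rw [hH, IntegralRep.domain_restrict])
    (fun z hz => by rw [hH, IntegralRep.integrand_restrict]; exact h1i (hSgsub hz))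
  set g : (Fin 2 → ℝ) → ℝ := fun z => 3 * (1 + z 0) / Real.sqrt ((z 0 ^ 3 + 1) ^ 2 - 4 * z 1 ^ 2 * z 0 ^ 3)
    with hg
  have hgs : IsSemialgebraicFunOn ℚ S2 g := by
    have hnum : IsSemialgebraicFunOn ℚ S2 (fun z => 3 * (1 + z 0)) :=
      (isSemialgebraicFunOn_aeval hS2s (C 3 * (1 + X 0) : MvPolynomial (Fin 2) ℚ)).congr fun z _ => by simp
    have hrad : IsSemialgebraicFunOn ℚ S2 (fun z => (z 0 ^ 3 + 1) ^ 2 - 4 * z 1 ^ 2 * z 0 ^ 3) :=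
      (isSemialgebraicFunOn_aeval hS2s ((X 0 ^ 3 + 1) ^ 2 - C 4 * X 1 ^ 2 * X 0 ^ 3 : MvPolynomial (Fin 2) ℚ)).congr
        fun z _ => by simp
    exact (hnum.div (IsSemialgebraicFunOn.sqrt_holds hrad) fun z hz =>
      (Real.sqrt_pos.2 (radicand_pos hz.1.1 hz.2.1.le hz.2.2)).ne').congr fun z _ => rfl
  have hmeas : MeasurableSet S2 := IsSemialgebraic.measurableSet_holds hS2s
  have hint : IntegrableOn g S2 := by
    have hA : IntegrableOn R₁.integrand S2 := R₁.integrableOn.mono_set hS2sub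
    have hB : IntegrableOn T.integrand S2 := by rw [hS2, ← hTd]; exact T.integrableOn
    refine (hA.add hB).congr_fun (fun z hz => ?_) hmeas
    rw [Pi.add_apply, h1i (hS2sub hz), hTi]
    simp only [hg]
    ring
  exact ⟨⟨S2, g, hS2s, hgs, hint⟩, rfl, rfl⟩

/-- **The unit band `R2band = [{0<x<1, 0≤y≤1}, 3(1+x)/Y]` exists** given `R2` (it exceeds the open
square by the null edges `y = 0`, `y = 1`). -/
theorem exists_R2band (R₂ : IntegralRep 2) (h2d : R₂.domain = {z | (0 < z 0 ∧ z 0 < 1) ∧ (0 < z 1 ∧ z 1 < 1)})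
    (h2i : R₂.integrand = fun z => 3 * (1 + z 0) / Real.sqrt ((z 0 ^ 3 + 1) ^ 2 - 4 * z 1 ^ 2 * z 0 ^ 3)) :
    ∃ Rb : IntegralRep 2, Rb.domain = KZlog.band {p : Fin 1 → ℝ | 0 < p 0 ∧ p 0 < 1} (fun _ => 0) (fun _ => 1) ∧
      Rb.integrand = fun z => 3 * (1 + z 0) / Real.sqrt ((z 0 ^ 3 + 1) ^ 2 - 4 * z 1 ^ 2 * z 0 ^ 3) := by
  set D : Set (Fin 2 → ℝ) := KZlog.band {p : Fin 1 → ℝ | 0 < p 0 ∧ p 0 < 1} (fun _ => 0) (fun _ => 1) with hD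
  have hinit : ∀ z : Fin 2 → ℝ, (Fin.init z) 0 = z 0 := fun z => rfl
  have hlast : (Fin.last 1 : Fin 2) = 1 := rfl
  have hmemD : ∀ z : Fin 2 → ℝ, z ∈ D ↔ (0 < z 0 ∧ z 0 < 1) ∧ 0 ≤ z 1 ∧ z 1 ≤ 1 := fun z => by
    rw [hD, KZlog.mem_band]
    simp only [mem_setOf_eq, hinit, hlast]
  have hDs : IsSemialgebraic ℚ D := by
    have h0 : IsSemialgebraicFunOn ℚ {p : Fin 1 → ℝ | 0 < p 0 ∧ p 0 < 1} (fun _ => (0:ℝ)) := by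
      simpa using isSemialgebraicFunOn_const_of_isAlgebraic isSemialgebraic_unitInterval_fin_one isAlgebraic_zero
    have h1 : IsSemialgebraicFunOn ℚ {p : Fin 1 → ℝ | 0 < p 0 ∧ p 0 < 1} (fun _ => (1:ℝ)) := by
      simpa using isSemialgebraicFunOn_const_of_isAlgebraic isSemialgebraic_unitInterval_fin_one isAlgebraic_one
    exact KZlog.isSemialgebraic_band h0 h1
  have hgs : IsSemialgebraicFunOn ℚ D
      (fun z => 3 * (1 + z 0) / Real.sqrt ((z 0 ^ 3 + 1) ^ 2 - 4 * z 1 ^ 2 * z 0 ^ 3)) := by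
    have hnum : IsSemialgebraicFunOn ℚ D (fun z => 3 * (1 + z 0)) :=
      (isSemialgebraicFunOn_aeval hDs (C 3 * (1 + X 0) : MvPolynomial (Fin 2) ℚ)).congr fun z _ => by simp
    have hrad : IsSemialgebraicFunOn ℚ D (fun z => (z 0 ^ 3 + 1) ^ 2 - 4 * z 1 ^ 2 * z 0 ^ 3) :=
      (isSemialgebraicFunOn_aeval hDs ((X 0 ^ 3 + 1) ^ 2 - C 4 * X 1 ^ 2 * X 0 ^ 3 : MvPolynomial (Fin 2) ℚ)).congr
        fun z _ => by simp
    refine (hnum.div (IsSemialgebraicFunOn.sqrt_holds hrad) fun z hz => ?_).congr fun z _ => rfl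
    rw [hmemD] at hz
    exact (Real.sqrt_pos.2 (radicand_pos_of_le_one hz.1.1 hz.1.2 hz.2.1 hz.2.2)).ne'
  have hCr : R₂.domain ⊆ R₂.domain := Subset.rfl
  have hnull : volume (D \ R₂.domain) = 0 := by
    have h0 : volume {z : Fin 2 → ℝ | z (Fin.last 1) = 0} = 0 := KZ.volume_setOf_last_eq_zero 0
    have h1 : volume {z : Fin 2 → ℝ | z (Fin.last 1) = 1} = 0 := KZ.volume_setOf_last_eq_zero 1
    refine measure_mono_null (fun z hz => ?_) (measure_union_null h0 h1)
    obtain ⟨hzD, hnot⟩ := hz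
    rw [hmemD] at hzD
    rw [h2d] at hnot
    simp only [mem_setOf_eq, not_and, not_lt] at hnot
    simp only [mem_union, mem_setOf_eq, hlast]
    rcases hzD.2.1.lt_or_eq with h | h
    · rcases hzD.2.2.lt_or_eq with h' | h'
      · exact absurd (hnot hzD.1 h) (not_le.2 h')
      · exact Or.inr h'
    · exact Or.inl h.symm
  obtain ⟨Rb, hRbd, hRbi⟩ := exists_rep_of_null_superset R₂ hDs (IntegralRep.measurableSet_domain_holds R₂)
    hCr hnull _ hgs (fun z _ => by rw [h2i])
  exact ⟨Rb, hRbd, hRbi⟩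

/-- **The `s`-band `R3 = [{0<x<1, 0 ≤ s ≤ 2x√x/(1+x³)}, (3/2)(1+x)/(x√x√(1-s²))]` exists** given the
unit band `R2band`: the affine chart `(x,s) ↦ (x, y = (1+x³)s/(2x√x))` maps the `s`-band onto the unit
band with Jacobian `(1+x³)/(2x√x)`, and pulls `3(1+x)/Y` back to the `R3` integrand
(`(x³+1)² - 4y²x³ = (x³+1)²(1-s²)`); integrability is transported (`exists_rep_of_preimage`). -/
theorem exists_R3 (R₂ : IntegralRep 2)
    (h2d : R₂.domain = KZlog.band {p : Fin 1 → ℝ | 0 < p 0 ∧ p 0 < 1} (fun _ => 0) (fun _ => 1))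
    (h2i : R₂.integrand = fun z => 3 * (1 + z 0) / Real.sqrt ((z 0 ^ 3 + 1) ^ 2 - 4 * z 1 ^ 2 * z 0 ^ 3)) :
    ∃ R₃ : IntegralRep 2, R₃.domain = KZlog.band {p : Fin 1 → ℝ | 0 < p 0 ∧ p 0 < 1} (fun _ => 0)
      (fun p => 2 * (p 0 * Real.sqrt (p 0)) / (1 + p 0 ^ 3)) ∧
      R₃.integrand = fun z => 3 / 2 * (1 + z 0) / (z 0 * Real.sqrt (z 0) * Real.sqrt (1 - z 1 ^ 2)) := by
  set G : Set (Fin 1 → ℝ) := {p : Fin 1 → ℝ | 0 < p 0 ∧ p 0 < 1} with hG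
  set D : Set (Fin 2 → ℝ) := KZlog.band G (fun _ => 0) (fun p => 2 * (p 0 * Real.sqrt (p 0)) / (1 + p 0 ^ 3))
    with hD
  set c : ℝ → ℝ := fun x => (1 + x ^ 3) / (2 * (x * Real.sqrt x)) with hc
  have hinit : ∀ z : Fin 2 → ℝ, (Fin.init z) 0 = z 0 := fun z => rfl
  have hlast : (Fin.last 1 : Fin 2) = 1 := rfl
  have hmemD : ∀ z : Fin 2 → ℝ, z ∈ D ↔ (0 < z 0 ∧ z 0 < 1) ∧ 0 ≤ z 1 ∧
      z 1 ≤ 2 * (z 0 * Real.sqrt (z 0)) / (1 + z 0 ^ 3) := fun z => by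
    rw [hD, KZlog.mem_band]
    simp only [hG, mem_setOf_eq, hinit, hlast]
  have hmem2 : ∀ z : Fin 2 → ℝ, z ∈ R₂.domain ↔ (0 < z 0 ∧ z 0 < 1) ∧ 0 ≤ z 1 ∧ z 1 ≤ 1 := fun z => by
    rw [h2d, KZlog.mem_band]
    simp only [hG, mem_setOf_eq, hinit, hlast]
  have hcpos : ∀ x : ℝ, 0 < x → 0 < c x := fun x hx => by simp only [hc]; positivity
  -- `c(x) · (2x√x/(1+x³)) = 1`
  have hcb : ∀ x : ℝ, 0 < x → c x * (2 * (x * Real.sqrt x) / (1 + x ^ 3)) = 1 := fun x hx => by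
    simp only [hc]
    rw [div_mul_div_comm, mul_comm ((1:ℝ) + x ^ 3), div_self (by positivity)]
  have hDs : IsSemialgebraic ℚ D := by
    have h0 : IsSemialgebraicFunOn ℚ G (fun _ => (0:ℝ)) := by
      simpa using isSemialgebraicFunOn_const_of_isAlgebraic isSemialgebraic_unitInterval_fin_one isAlgebraic_zero
    exact KZlog.isSemialgebraic_band h0 (isSemialgebraicFunOn_tailSubst isSemialgebraic_unitInterval_fin_one
      fun p hp => hp.1.le)
  -- the integrand of `R3` is semialgebraic on `D`
  set f : (Fin 2 → ℝ) → ℝ := fun z => 3 / 2 * (1 + z 0) / (z 0 * Real.sqrt (z 0) * Real.sqrt (1 - z 1 ^ 2))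
    with hf
  have hslt : ∀ z ∈ D, z 1 < 1 := fun z hz => by
    rw [hmemD] at hz
    exact hz.2.2.trans_lt (tailSubst_lt_one hz.1.1 hz.1.2)
  have hfs : IsSemialgebraicFunOn ℚ D f := by
    have hnum : IsSemialgebraicFunOn ℚ D (fun z => 3 / 2 * (1 + z 0)) :=
      (isSemialgebraicFunOn_aeval hDs (C (3 / 2) * (1 + X 0) : MvPolynomial (Fin 2) ℚ)).congr fun z _ => by
        simp
    have hX0 : IsSemialgebraicFunOn ℚ D (fun z => z 0) :=
      (isSemialgebraicFunOn_aeval hDs (X 0 : MvPolynomial (Fin 2) ℚ)).congr fun z _ => by simp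
    have h1s : IsSemialgebraicFunOn ℚ D (fun z => 1 - z 1 ^ 2) :=
      (isSemialgebraicFunOn_aeval hDs (1 - X 1 ^ 2 : MvPolynomial (Fin 2) ℚ)).congr fun z _ => by simp
    have hden : IsSemialgebraicFunOn ℚ D (fun z => z 0 * Real.sqrt (z 0) * Real.sqrt (1 - z 1 ^ 2)) :=
      (IsSemialgebraicFunOn.mul_holds (IsSemialgebraicFunOn.mul_holds hX0 (IsSemialgebraicFunOn.sqrt_holds hX0))
        (IsSemialgebraicFunOn.sqrt_holds h1s)).congr fun z _ => rfl
    refine (hnum.div hden fun z hz => ?_).congr fun z _ => rfl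
    have hz' := (hmemD z).1 hz
    have h1 : 0 < 1 - z 1 ^ 2 := by nlinarith [hslt z hz, hz'.2.1]
    have := hz'.1.1
    positivity
  -- the affine chart and its derivative
  set Φ : (Fin 2 → ℝ) → (Fin 2 → ℝ) := fun z => (![z 0, c (z 0) * z 1] : Fin 2 → ℝ) with hΦ
  set Φ' : (Fin 2 → ℝ) → (Fin 2 → ℝ) →L[ℝ] (Fin 2 → ℝ) := fun z =>
    LinearMap.toContinuousLinearMap (Matrix.toLin' !![1, 0; deriv c (z 0) * z 1, c (z 0)]) with hΦ'
  have hder : ∀ z ∈ D, HasFDerivWithinAt Φ (Φ' z) D z := by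
    intro z hz
    have hx : 0 < z 0 := ((hmemD z).1 hz).1.1
    have h0 : HasFDerivAt (fun w : Fin 2 → ℝ => w 0)
        (ContinuousLinearMap.proj (R := ℝ) (φ := fun _ : Fin 2 => ℝ) 0) z := hasFDerivAt_apply 0 z
    have h1 : HasFDerivAt (fun w : Fin 2 → ℝ => w 1)
        (ContinuousLinearMap.proj (R := ℝ) (φ := fun _ : Fin 2 => ℝ) 1) z := hasFDerivAt_apply 1 z
    have hcd : HasDerivAt c (deriv c (z 0)) (z 0) := (differentiableAt_affineCoeff hx).hasDerivAt
    have hcomp := (hcd.comp_hasFDerivAt z h0).mul h1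
    refine HasFDerivAt.hasFDerivWithinAt (hasFDerivAt_pi'.mpr fun i => ?_)
    fin_cases i
    · refine (h0.congr_fderiv ?_).congr_of_eventuallyEq (Filter.Eventually.of_forall fun w => by simp [hΦ])
      ext v
      simp [hΦ', Matrix.toLin'_apply, dotProduct, Fin.sum_univ_two]
    · refine (hcomp.congr_fderiv ?_).congr_of_eventuallyEq (Filter.Eventually.of_forall fun w => by
        simp [hΦ, Function.comp_def])
      ext v
      simp [hΦ', Matrix.toLin'_apply, dotProduct, Fin.sum_univ_two]
      ring
  have hdet : ∀ z, (Φ' z).det = c (z 0) := fun z => by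
    show LinearMap.det (Matrix.toLin' !![1, 0; deriv c (z 0) * z 1, c (z 0)]) = _
    rw [LinearMap.det_toLin', Matrix.det_fin_two_of]
    ring
  have hinj : InjOn Φ D := by
    intro z hz w hw h
    have h0 := congr_fun h 0
    have h1 := congr_fun h 1
    simp only [hΦ, Matrix.cons_val_zero, Matrix.cons_val_one] at h0 h1
    have hx : z 0 = w 0 := h0
    rw [hx] at h1
    have hy : z 1 = w 1 := mul_left_cancel₀ (hcpos _ ((hmemD w).1 hw).1.1).ne' h1
    ext i
    fin_cases i
    · exact hx
    · exact hy
  have himage : Φ '' D = R₂.domain := by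
    ext y
    rw [hmem2, mem_image]
    constructor
    · rintro ⟨z, hz, rfl⟩
      have hz' := (hmemD z).1 hz
      have hx := hz'.1.1
      refine ⟨by simpa [hΦ] using hz'.1, ?_, ?_⟩
      · show 0 ≤ c (z 0) * z 1
        exact mul_nonneg (hcpos _ hx).le hz'.2.1
      · show c (z 0) * z 1 ≤ 1
        calc c (z 0) * z 1 ≤ c (z 0) * (2 * (z 0 * Real.sqrt (z 0)) / (1 + z 0 ^ 3)) :=
              mul_le_mul_of_nonneg_left hz'.2.2 (hcpos _ hx).le
          _ = 1 := hcb _ hx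
    · rintro ⟨hx, hy0, hy1⟩
      refine ⟨![y 0, y 1 / c (y 0)], ?_, ?_⟩
      · rw [hmemD]
        refine ⟨by simpa using hx, by simpa using div_nonneg hy0 (hcpos _ hx.1).le, ?_⟩
        show y 1 / c (y 0) ≤ 2 * ((![y 0, y 1 / c (y 0)] : Fin 2 → ℝ) 0 *
          Real.sqrt ((![y 0, y 1 / c (y 0)] : Fin 2 → ℝ) 0)) / (1 + (![y 0, y 1 / c (y 0)] : Fin 2 → ℝ) 0 ^ 3)
        simp only [Matrix.cons_val_zero]
        rw [div_le_iff₀ (hcpos _ hx.1)]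
        calc y 1 ≤ 1 := hy1
          _ = c (y 0) * (2 * (y 0 * Real.sqrt (y 0)) / (1 + y 0 ^ 3)) := (hcb _ hx.1).symm
          _ = 2 * (y 0 * Real.sqrt (y 0)) / (1 + y 0 ^ 3) * c (y 0) := mul_comm _ _
      · ext i
        fin_cases i
        · simp [hΦ]
        · show c ((![y 0, y 1 / c (y 0)] : Fin 2 → ℝ) 0) * (![y 0, y 1 / c (y 0)] : Fin 2 → ℝ) 1 = y 1
          simp only [Matrix.cons_val_zero, Matrix.cons_val_one]
          field_simp [(hcpos _ hx.1).ne']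
  -- the pull-back identity
  have hint : ∀ z ∈ D, f z = R₂.integrand (Φ z) * |(Φ' z).det| := by
    intro z hz
    have hz' := (hmemD z).1 hz
    have hx0 := hz'.1.1
    have hs1 : z 1 < 1 := hslt z hz
    have hs0 : 0 ≤ z 1 := hz'.2.1
    rw [hdet, abs_of_pos (hcpos _ hx0), h2i]
    simp only [hf, hΦ, hc, Matrix.cons_val_zero, Matrix.cons_val_one]
    -- write `z 0 = q²`
    obtain ⟨q, hq0, hzq⟩ : ∃ q : ℝ, 0 < q ∧ z 0 = q ^ 2 :=
      ⟨Real.sqrt (z 0), Real.sqrt_pos.2 hx0, (Real.sq_sqrt hx0.le).symm⟩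
    have h1z : 0 < 1 - z 1 ^ 2 := by nlinarith
    have hs2 : 0 < Real.sqrt (1 - z 1 ^ 2) := Real.sqrt_pos.2 h1z
    rw [hzq, Real.sqrt_sq hq0.le]
    have hrad : ((q ^ 2) ^ 3 + 1) ^ 2 - 4 * ((1 + (q ^ 2) ^ 3) / (2 * (q ^ 2 * q)) * z 1) ^ 2 * (q ^ 2) ^ 3 =
        ((1 + (q ^ 2) ^ 3) * Real.sqrt (1 - z 1 ^ 2)) ^ 2 := by
      rw [mul_pow ((1:ℝ) + (q ^ 2) ^ 3), Real.sq_sqrt h1z.le]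
      field_simp
      ring
    rw [hrad, Real.sqrt_sq (by positivity)]
    field_simp
  obtain ⟨R₃, h3d, h3i⟩ := exists_rep_of_preimage R₂ hDs Φ Φ' hder hinj himage f hfs hint
  exact ⟨R₃, h3d, h3i⟩

end Summit.KontsevichZagierPeriods.KontsevichZagierPeriods.Theorems.GKZLevelThree

end
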